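import Summits.AtomisticToContinuum.BoseEinsteinCondensation.Theorems.BECThomsonPrincipleFibreConductanceStubThomson
import Summits.AtomisticToContinuum.BoseEinsteinCondensation.Theorems.BECThomsonPrincipleFibreConductanceStubTransport
import HarnessLib

/-!
# Route `BECThomsonPrinciple`, crux `FibreConductance` (stmt-AtomisticToContinuum-9480) —
# THE CRUX IN DUAL FORM: `FibreConductance ↔ FibreDualBound`

With both halves of Thomson duality for fibre flows in the tree — the lower bound
`norm_pairing_sq_le` (`Theorems/FibreConductance/Negative/FibreVocabulary.lean`: a flow of cost `≤ K`
bounds every pairing, `‖∫qη‖² ≤ K·∫|∇₀η|²ψ²/W`) and the realisation `stub_thomson`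
(`Theorems/BECThomsonPrincipleFibreConductanceStubThomson.lean`: a dual bound produces a flow of that
cost) — the crux `FibreConductance` (existence of ONE fibre flow of the charge
`q = L^{-3/2}(e^{ik·x₀}ψ − βψ²)` with cost `≤ CL²/‖n‖²`) is EQUIVALENT to a pure inequality on exact
ground states, with the same constants: for every `C¹` periodic test function `η`,
`‖∫_{cellN} q η‖² ≤ (CL²/‖n‖²) · ∫_{cellN} |∇₀η|² ψ²/W` (`FibreDualBound`). No flow has to be
constructed by any line: the crux is the statement that the `H⁻¹(ψ²/W dX)`-norm of the fibre-neutral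
charge `q` is `O(L/‖n‖)`, i.e. a bath-averaged weighted Poincaré-type inequality for the single test
direction `q`.

* `FibreDualBound` — the dual form (same quantifier prefix `LowDensityWindow` as the crux).
* `fibreConductance_of_dualBound : ThomsonRealisation → FibreDualBound → FibreConductance`.
* `dualBound_of_fibreConductance : FibreConductance → FibreDualBound`.
* `fibreConductance_iff_dual : FibreConductance ↔ FibreDualBound` (anchor stub).
* `BetaDualBound`, `defectDual_of_gradient_and_beta : GradientDualBound → BetaDualBound → DefectDualBound`,
  `fibreConductance_of_dual_channels : GradientDualBound → BetaDualBound → FibreConductance` — both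
  correctors may be delivered as inequalities (`gradientDualBound_of_correctorBound`,
  `betaDualBound_of_correctorBound`: the flow forms imply them).
* `DefectDualBound`, `fibreConductance_iff_defectDual : FibreConductance ↔ DefectDualBound` — the same
  with the EXPLICIT defect charge `ε = ε♭ + ε♮ = div₀J₀ − q` of the landed transport flow in place of
  `q` (`q = (q + ε) − ε`, `‖∫(q+ε)η‖² ≤ (1/4π²)(L²/‖n‖²)E(η)` by the transport flow's cost): the crux is
  the statement that the `H⁻¹(ψ²/W)`-norm of `ε` — which vanishes identically for the free gas — is
  `O(L/‖n‖)` for exact interacting ground states.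
-/

noncomputable section

namespace Summit.AtomisticToContinuum.BoseEinsteinCondensation.Cruxes.FibreConductance.HealingSplitKineticDefect

open MeasureTheory
open scoped ENNReal
open Literature.MathematicalPhysics.QuantumManyBody.BoseGas
open Summit.AtomisticToContinuum.BoseEinsteinCondensation.Theses.BECThomsonPrinciple (FibreConductance)
open Summit.AtomisticToContinuum.BoseEinsteinCondensation.Cruxes.FibreConductance.ParsevalShellBootstrap
open Summit.AtomisticToContinuum.BoseEinsteinCondensation.Theorems.FibreConductance.Negative
  (IsFibreFlow norm_pairing_sq_le)
open Summit.AtomisticToContinuum.BoseEinsteinCondensation.Theorems.GaussianDominationCan.Negative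
  (one_le_norm_intVec)

variable {m : ℕ} {L : ℝ}

/-- The crux's fibre-neutral charge `q = L^{-3/2}(e^{ik·x₀}ψ − βψ²)` (verbatim the crux's `q`, over the
landed vocabulary). [folklore] -/
def fibreCharge (n : Fin 3 → ℤ) (Φ : PeriodicTrialState (m + 1) L) (X : Config (m + 1)) : ℂ :=
  ((Real.sqrt (L ^ 3))⁻¹ : ℂ) *
    (phase L n (X 0) * (fibrePsi Φ X : ℂ) - fibreBeta n Φ X * (fibrePsi Φ X : ℂ) ^ 2)

/-- The charge `q` of a zero-free state is continuous (`L > 0`). [folklore] -/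
theorem continuous_fibreCharge (hL : 0 < L) (n : Fin 3 → ℤ) (Φ : PeriodicTrialState (m + 1) L)
    (hΦ : ∀ X, Φ.ψ X ≠ 0) : Continuous (fibreCharge n Φ) := by
  have hphase : Continuous (phase L n) := (contDiff_phase L n (k := 0)).continuous
  have hψ := continuous_fibrePsi hL Φ hΦ
  have hβ := continuous_fibreBeta hL n Φ hΦ
  unfold fibreCharge
  fun_prop

/-- **A flow bounds every pairing** (`norm_pairing_sq_le` with the weight `w = W/ψ²`, in the
`ℝ≥0∞` vocabulary of `HasDualBound`): a fibre flow of `σ` with Thomson cost `≤ K` (`K > 0`) gives the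
dual bound `‖∫ση‖² ≤ K·∫|∇₀η|²ψ²/W` for every test `η`. [folklore] -/
theorem hasDualBound_of_hasWeakDiv (hL : 0 < L) (Φ : PeriodicTrialState (m + 1) L)
    (hΦ : ∀ X, Φ.ψ X ≠ 0) {σ : Config (m + 1) → ℂ} {J : Config (m + 1) → Fin 3 → ℂ} {K : ℝ}
    (hK : 0 < K) (hJ : HasWeakDiv L J σ) (hc : fibreCost Φ J ≤ ENNReal.ofReal K) :
    HasDualBound Φ σ (ENNReal.ofReal K) := by
  have hJf : IsFibreFlow m L σ J := hJ
  intro η hη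
  -- the weight `W/ψ²`
  set w : Config (m + 1) → ℝ := fun X => fibreW Φ X / fibrePsi Φ X ^ 2 with hw_def
  have hwpos : ∀ X, 0 < w X := fun X =>
    div_pos (fibreW_pos hL Φ hΦ X) (pow_pos (fibrePsi_pos hL Φ hΦ X) 2)
  have hwm : Measurable w := (measurable_fibreW Φ).div ((measurable_fibrePsi hL Φ hΦ).pow_const 2)
  have hcost : ∫⁻ X in cellN (m + 1) L, ENNReal.ofReal ((∑ l : Fin 3, ‖J X l‖ ^ 2) * w X) ≤
      ENNReal.ofReal K := by
    refine le_of_eq_of_le (lintegral_congr fun X => ?_) hc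
    simp only [hw_def, mul_div_assoc]
  by_cases htop : dualEnergy Φ η = ⊤
  · rw [htop, ENNReal.mul_top (ENNReal.ofReal_pos.2 hK).ne']
    exact le_top
  · have hD := ENNReal.toReal_nonneg (a := dualEnergy Φ η)
    have hdual : ∫⁻ X in cellN (m + 1) L, ENNReal.ofReal
        ((∑ l : Fin 3, ‖fderiv ℝ η X (Pi.single 0 (EuclideanSpace.single l (1 : ℝ)))‖ ^ 2) / w X) ≤
        ENNReal.ofReal (dualEnergy Φ η).toReal := by
      rw [ENNReal.ofReal_toReal htop]
      refine le_of_eq (lintegral_congr fun X => ?_)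
      rw [hw_def, div_div_eq_mul_div, mul_div_assoc]
      rfl
    have key := norm_pairing_sq_le hJf hη.1 hη.2 hwpos hwm hK.le hD hcost hdual
    calc ENNReal.ofReal (‖∫ X in cellN (m + 1) L, σ X * η X‖ ^ 2)
        ≤ ENNReal.ofReal (K * (dualEnergy Φ η).toReal) := ENNReal.ofReal_le_ofReal key
      _ = ENNReal.ofReal K * dualEnergy Φ η := by
          rw [ENNReal.ofReal_mul hK.le, ENNReal.ofReal_toReal htop]

/-- `ℝ≥0∞` form of `‖a − b‖² ≤ 2‖a‖² + 2‖b‖²`. [folklore] -/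
theorem ofReal_norm_sub_sq_le (a b : ℂ) :
    ENNReal.ofReal (‖a - b‖ ^ 2) ≤ 2 * ENNReal.ofReal (‖a‖ ^ 2) + 2 * ENNReal.ofReal (‖b‖ ^ 2) := by
  have h2 : (2 : ℝ≥0∞) = ENNReal.ofReal 2 := by norm_num
  rw [h2, ← ENNReal.ofReal_mul zero_le_two, ← ENNReal.ofReal_mul zero_le_two,
    ← ENNReal.ofReal_add (by positivity) (by positivity)]
  refine ENNReal.ofReal_le_ofReal ?_
  nlinarith [norm_sub_le a b, norm_nonneg (a - b), norm_nonneg a, norm_nonneg b,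
    sq_nonneg (‖a‖ - ‖b‖)]

/-- **Dual bounds subtract** (continuous charges): levels `2B₁ + 2B₂`. [folklore] -/
theorem HasDualBound.sub {Φ : PeriodicTrialState (m + 1) L} {σ₁ σ₂ : Config (m + 1) → ℂ}
    {B₁ B₂ : ℝ≥0∞} (h₁ : HasDualBound Φ σ₁ B₁) (h₂ : HasDualBound Φ σ₂ B₂) (hσ₁ : Continuous σ₁)
    (hσ₂ : Continuous σ₂) :
    HasDualBound Φ (fun X => σ₁ X - σ₂ X) (2 * B₁ + 2 * B₂) := by
  intro η hη
  have hi : ∀ {σ : Config (m + 1) → ℂ}, Continuous σ →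
      Integrable (fun X => σ X * η X) (volume.restrict (cellN (m + 1) L)) :=
    fun hσ => integrableOn_cellN (hσ.mul hη.1.continuous) L
  have e : (fun X => (σ₁ X - σ₂ X) * η X) = fun X => σ₁ X * η X - σ₂ X * η X :=
    funext fun X => by ring
  rw [e, integral_sub (hi hσ₁) (hi hσ₂)]
  calc ENNReal.ofReal (‖(∫ X in cellN (m + 1) L, σ₁ X * η X) -
          ∫ X in cellN (m + 1) L, σ₂ X * η X‖ ^ 2)
      ≤ 2 * ENNReal.ofReal (‖∫ X in cellN (m + 1) L, σ₁ X * η X‖ ^ 2) +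
          2 * ENNReal.ofReal (‖∫ X in cellN (m + 1) L, σ₂ X * η X‖ ^ 2) := ofReal_norm_sub_sq_le _ _
    _ ≤ 2 * (B₁ * dualEnergy Φ η) + 2 * (B₂ * dualEnergy Φ η) := by
        gcongr
        · exact h₁ η hη
        · exact h₂ η hη
    _ = (2 * B₁ + 2 * B₂) * dualEnergy Φ η := by ring

/-- THE CRUX IN DUAL FORM (a reformulation of `FibreConductance`, not a literature fact): in the crux's
window, for exact zero-free minimisers, `‖∫ q η‖² ≤ (C L²/‖n‖²)·∫|∇₀η|²ψ²/W` for every `C¹`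
periodic test function `η`. -/
def FibreDualBound : Prop :=
  LowDensityWindow fun _ L n Φ C =>
    HasDualBound Φ (fibreCharge n Φ) (ENNReal.ofReal (C * L ^ 2 / ‖(fun j => (n j : ℝ))‖ ^ 2))

/-- **Dual bound ⇒ crux** (realisation half of Thomson duality). [folklore] -/
theorem fibreConductance_of_dualBound (th : ThomsonRealisation) (hd : FibreDualBound) :
    FibreConductance := by
  intro v hv hB M hM
  obtain ⟨ρ₀, C, hρ₀, hC, N₀, h⟩ := hd v hv hB M hM
  refine ⟨ρ₀, C, hρ₀, hC, N₀, fun m hm L hL hρ n hn hw Φ hE hz => ?_⟩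
  obtain ⟨J, -, hJd, hJc⟩ := th m L hL Φ hz (fibreCharge n Φ) (continuous_fibreCharge hL n Φ hz) _
    (by positivity) (h m hm L hL hρ n hn hw Φ hE hz)
  exact ⟨J, hJd, hJc⟩

/-- **Crux ⇒ dual bound** (lower-bound half of Thomson duality, `norm_pairing_sq_le` with the weight
`w = W/ψ²`). [folklore] -/
theorem dualBound_of_fibreConductance (hcrux : FibreConductance) : FibreDualBound := by
  intro v hv hB M hM
  obtain ⟨ρ₀, C, hρ₀, hC, N₀, h⟩ := hcrux v hv hB M hM
  refine ⟨ρ₀, C, hρ₀, hC, N₀, fun m hm L hL hρ n hn hw Φ hE hz => ?_⟩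
  obtain ⟨J, hJd, hJc⟩ := h m hm L hL hρ n hn hw Φ hE hz
  have hn1 := one_le_norm_intVec hn
  exact hasDualBound_of_hasWeakDiv hL Φ hz (by positivity) hJd hJc

/-! ## The crux in DEFECT dual form -/

/-- `L²/‖n‖²`, the crux's budget unit. [folklore] -/
def budgetUnit (L : ℝ) (n : Fin 3 → ℤ) : ℝ := L ^ 2 / ‖(fun j => (n j : ℝ))‖ ^ 2

/-- THE DEFECT CHARGE `ε = ε♭ + ε♮ = div₀J₀ − q` of the transport flow `J₀ = L^{-3/2}e^{ik·x₀}ψ k/(i|k|²)`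
(`gradDefect + densDefect`; explicitly `L^{-3/2}[e^{ik·x₀}(k·∇₀ψ)/(i|k|²) + βψ²]`; `≡ 0` for the
constant state). [folklore] -/
def defectCharge (n : Fin 3 → ℤ) (Φ : PeriodicTrialState (m + 1) L) (X : Config (m + 1)) : ℂ :=
  gradDefect n Φ X + densDefect n Φ X

/-- The defect charge of a zero-free state is continuous (`L > 0`). [folklore] -/
theorem continuous_defectCharge (hL : 0 < L) (n : Fin 3 → ℤ) (Φ : PeriodicTrialState (m + 1) L)
    (hΦ : ∀ X, Φ.ψ X ≠ 0) : Continuous (defectCharge n Φ) := by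
  have hphase : Continuous (phase L n) := (contDiff_phase L n (k := 0)).continuous
  have hψ := continuous_fibrePsi hL Φ hΦ
  have hβ := continuous_fibreBeta hL n Φ hΦ
  have hd : ∀ l : Fin 3, Continuous fun X => dPsi Φ X l := continuous_dPsi hL Φ hΦ
  unfold defectCharge gradDefect densDefect
  fun_prop

/-- THE CRUX IN DEFECT DUAL FORM (a reformulation of `FibreConductance`, not a literature fact): in the
crux's window, for exact zero-free minimisers, the defect charge `ε` has dual bound
`‖∫εη‖² ≤ (D L²/‖n‖²)·∫|∇₀η|²ψ²/W` for every `C¹` periodic test function `η`. -/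
def DefectDualBound : Prop :=
  LowDensityWindow fun _ L n Φ D =>
    HasDualBound Φ (defectCharge n Φ) (ENNReal.ofReal (D * budgetUnit L n))

/-- **The transport flow bounds the pairings of `q + ε`**: `‖∫(q+ε)η‖² ≤ (1/4π²)(L²/‖n‖²)·E(η)`
(`tr_hasWeakDiv_transport`, `tr_div_identity`, `tr_cost_transport` of the landed transport step, and
`hasDualBound_of_hasWeakDiv`). [folklore] -/
theorem hasDualBound_charge_add_defect (hL : 0 < L) {n : Fin 3 → ℤ} (hn : n ≠ 0)
    (Φ : PeriodicTrialState (m + 1) L) (hΦ : ∀ X, Φ.ψ X ≠ 0) :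
    HasDualBound Φ (fun X => fibreCharge n Φ X + defectCharge n Φ X)
      (ENNReal.ofReal (1 / (4 * Real.pi ^ 2) * budgetUnit L n)) := by
  set a : Fin 3 → ℂ := fun l => ((Real.sqrt (L ^ 3))⁻¹ : ℂ) *
    ((2 * Real.pi * (n l : ℝ) / L : ℝ) : ℂ) / (Complex.I * (ksq L n : ℂ)) with ha
  have hdiv : HasWeakDiv L (fun X l => a l * (phase L n (X 0) * (fibrePsi Φ X : ℂ)))
      (fun X => fibreCharge n Φ X + defectCharge n Φ X) := by
    have h := tr_hasWeakDiv_transport hL n Φ hΦ a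
    have he : (fun X => ∑ l : Fin 3, a l * (phase L n (X 0) *
        ((dPsi Φ X l : ℂ) + 2 * Real.pi * Complex.I * (n l) / L * (fibrePsi Φ X : ℂ)))) =
        fun X => fibreCharge n Φ X + defectCharge n Φ X := by
      funext X
      rw [tr_div_identity hL hn Φ X]
      unfold fibreCharge defectCharge
      ring
    rw [← he]
    exact h
  have hn1 := one_le_norm_intVec hn
  refine hasDualBound_of_hasWeakDiv hL Φ hΦ (by unfold budgetUnit; positivity) hdiv ?_
  unfold budgetUnit
  rw [← mul_div_assoc]
  exact tr_cost_transport hL hn Φ hΦ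

/-- `ℝ≥0∞` bookkeeping: `2·ofReal(ax) + 2·ofReal(bx) = ofReal(2(a+b)x)` for `a, b, x ≥ 0`. [folklore] -/
theorem two_mul_ofReal_add (a b x : ℝ) (ha : 0 ≤ a) (hb : 0 ≤ b) (hx : 0 ≤ x) :
    2 * ENNReal.ofReal (a * x) + 2 * ENNReal.ofReal (b * x) = ENNReal.ofReal (2 * (a + b) * x) := by
  have h2 : (2 : ℝ≥0∞) = ENNReal.ofReal 2 := by norm_num
  rw [h2, ← ENNReal.ofReal_mul zero_le_two, ← ENNReal.ofReal_mul zero_le_two,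
    ← ENNReal.ofReal_add (by positivity) (by positivity)]
  congr 1
  ring

/-- **Defect dual bound ⇒ dual bound of `q`**: `q = (q + ε) − ε`, constant `2(1/4π² + D)`. [folklore] -/
theorem fibreDualBound_of_defectDual (hd : DefectDualBound) : FibreDualBound := by
  intro v hv hB M hM
  obtain ⟨ρ₀, D, hρ₀, hD, N₀, h⟩ := hd v hv hB M hM
  refine ⟨ρ₀, 2 * (1 / (4 * Real.pi ^ 2) + D), hρ₀, by positivity, N₀,
    fun m hm L hL hρ n hn hw Φ hE hz => ?_⟩
  have hε := h m hm L hL hρ n hn hw Φ hE hz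
  have hq := (hasDualBound_charge_add_defect hL hn Φ hz).sub hε
    ((continuous_fibreCharge hL n Φ hz).add (continuous_defectCharge hL n Φ hz))
    (continuous_defectCharge hL n Φ hz)
  have e : (fun X => fibreCharge n Φ X + defectCharge n Φ X - defectCharge n Φ X) =
      fibreCharge n Φ := funext fun X => by ring
  rw [e] at hq
  refine hq.mono (le_of_eq ?_)
  rw [two_mul_ofReal_add _ _ _ (by positivity) hD.le (by unfold budgetUnit; positivity)]
  unfold budgetUnit
  rw [mul_div_assoc]

/-- **Dual bound of `q` ⇒ defect dual bound**: `ε = (q + ε) − q`, constant `2(1/4π² + C)`. [folklore] -/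
theorem defectDual_of_fibreDualBound (hq : FibreDualBound) : DefectDualBound := by
  intro v hv hB M hM
  obtain ⟨ρ₀, C, hρ₀, hC, N₀, h⟩ := hq v hv hB M hM
  refine ⟨ρ₀, 2 * (1 / (4 * Real.pi ^ 2) + C), hρ₀, by positivity, N₀,
    fun m hm L hL hρ n hn hw Φ hE hz => ?_⟩
  have hqε := h m hm L hL hρ n hn hw Φ hE hz
  have hε := (hasDualBound_charge_add_defect hL hn Φ hz).sub hqε
    ((continuous_fibreCharge hL n Φ hz).add (continuous_defectCharge hL n Φ hz))
    (continuous_fibreCharge hL n Φ hz)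
  have e : (fun X => fibreCharge n Φ X + defectCharge n Φ X - fibreCharge n Φ X) =
      defectCharge n Φ := funext fun X => by ring
  rw [e] at hε
  refine hε.mono (le_of_eq ?_)
  have hx : 0 ≤ budgetUnit L n := by unfold budgetUnit; positivity
  rw [show C * L ^ 2 / ‖(fun j => (n j : ℝ))‖ ^ 2 = C * budgetUnit L n by
    unfold budgetUnit; rw [mul_div_assoc], two_mul_ofReal_add _ _ _ (by positivity) hC.le hx]


/-! ## The two channels in dual form -/

/-- **Dual bounds add** (continuous charges): levels `2B₁ + 2B₂`. [folklore] -/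
theorem HasDualBound.add {Φ : PeriodicTrialState (m + 1) L} {σ₁ σ₂ : Config (m + 1) → ℂ}
    {B₁ B₂ : ℝ≥0∞} (h₁ : HasDualBound Φ σ₁ B₁) (h₂ : HasDualBound Φ σ₂ B₂) (hσ₁ : Continuous σ₁)
    (hσ₂ : Continuous σ₂) :
    HasDualBound Φ (fun X => σ₁ X + σ₂ X) (2 * B₁ + 2 * B₂) := by
  have h := h₁.sub (B₂ := B₂) (σ₂ := fun X => -σ₂ X) (fun η hη => by
    have e : (fun X => -σ₂ X * η X) = fun X => -(σ₂ X * η X) := funext fun X => by ring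
    rw [e, integral_neg, norm_neg]
    exact h₂ η hη) hσ₁ hσ₂.neg
  have e : (fun X => σ₁ X - -σ₂ X) = fun X => σ₁ X + σ₂ X := funext fun X => by ring
  rwa [e] at h

/-- β-CHANNEL DUAL BOUND (the dual form of `BetaCorrectorBound`; a goal, not a literature fact): in the
crux's window the β-charge `ε♮ = densDefect` has dual bound `‖∫ε♮η‖² ≤ (C L²/‖n‖²)·E(η)`. -/
def BetaDualBound : Prop :=
  LowDensityWindow fun _ L n Φ C =>
    HasDualBound Φ (densDefect n Φ) (ENNReal.ofReal (C * L ^ 2 / ‖(fun j => (n j : ℝ))‖ ^ 2))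

/-- The β-charge `ε♮` of a zero-free state is continuous (`L > 0`). [folklore] -/
theorem continuous_densDefect (hL : 0 < L) (n : Fin 3 → ℤ) (Φ : PeriodicTrialState (m + 1) L)
    (hΦ : ∀ X, Φ.ψ X ≠ 0) : Continuous (densDefect n Φ) := by
  have hψ := continuous_fibrePsi hL Φ hΦ
  have hβ := continuous_fibreBeta hL n Φ hΦ
  unfold densDefect
  fun_prop

/-- **The two channels in dual form give the defect dual bound** (`ε = ε♭ + ε♮`, constant
`2C♭ + 2C♮`): with `fibreConductance_iff_defectDual`, EVERY line of this crux may deliver its gradient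
and β correctors as inequalities (`GradientDualBound`, `BetaDualBound`) instead of flows. [folklore] -/
theorem defectDual_of_gradient_and_beta (hg : GradientDualBound) (hb : BetaDualBound) :
    DefectDualBound := by
  intro v hv hB M hM
  obtain ⟨ρ₁, C₁, hρ₁, hC₁, N₁, h₁⟩ := hg v hv hB M hM
  obtain ⟨ρ₂, C₂, hρ₂, hC₂, N₂, h₂⟩ := hb v hv hB M hM
  refine ⟨min ρ₁ ρ₂, 2 * C₁ + 2 * C₂, lt_min hρ₁ hρ₂, by positivity, max N₁ N₂, ?_⟩
  intro m hm L hL hρ n hn hw Φ hE hz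
  have hL3 : (0 : ℝ) ≤ L ^ 3 := by positivity
  have hd₁ := h₁ m (le_trans (le_max_left _ _) hm) L hL
    (hρ.trans (mul_le_mul_of_nonneg_right (min_le_left _ _) hL3)) n hn hw Φ hE hz
  have hd₂ := h₂ m (le_trans (le_max_right _ _) hm) L hL
    (hρ.trans (mul_le_mul_of_nonneg_right (min_le_right _ _) hL3)) n hn hw Φ hE hz
  have h := hd₁.add hd₂ (continuous_gradDefect hL n Φ hz) (continuous_densDefect hL n Φ hz)
  refine h.mono (le_of_eq ?_)
  have hx : 0 ≤ budgetUnit L n := by unfold budgetUnit; positivity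
  rw [show C₁ * L ^ 2 / ‖(fun j => (n j : ℝ))‖ ^ 2 = C₁ * budgetUnit L n by
      unfold budgetUnit; rw [mul_div_assoc],
    show C₂ * L ^ 2 / ‖(fun j => (n j : ℝ))‖ ^ 2 = C₂ * budgetUnit L n by
      unfold budgetUnit; rw [mul_div_assoc],
    two_mul_ofReal_add _ _ _ hC₁.le hC₂.le hx]
  congr 1
  ring

/-- Flow form ⇒ dual form for the gradient corrector. [folklore] -/
theorem gradientDualBound_of_correctorBound (h : GradientCorrectorBound) : GradientDualBound := by
  intro v hv hB M hM
  obtain ⟨ρ₀, C, hρ₀, hC, N₀, h⟩ := h v hv hB M hM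
  refine ⟨ρ₀, C, hρ₀, hC, N₀, fun m hm L hL hρ n hn hw Φ hE hz => ?_⟩
  obtain ⟨J, -, hJd, hJc⟩ := h m hm L hL hρ n hn hw Φ hE hz
  have hn1 := one_le_norm_intVec hn
  exact hasDualBound_of_hasWeakDiv hL Φ hz (by positivity) hJd hJc

/-- Flow form ⇒ dual form for the β-corrector. [folklore] -/
theorem betaDualBound_of_correctorBound (h : BetaCorrectorBound) : BetaDualBound := by
  intro v hv hB M hM
  obtain ⟨ρ₀, C, hρ₀, hC, N₀, h⟩ := h v hv hB M hM
  refine ⟨ρ₀, C, hρ₀, hC, N₀, fun m hm L hL hρ n hn hw Φ hE hz => ?_⟩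
  obtain ⟨J, -, hJd, hJc⟩ := h m hm L hL hρ n hn hw Φ hE hz
  have hn1 := one_le_norm_intVec hn
  exact hasDualBound_of_hasWeakDiv hL Φ hz (by positivity) hJd hJc

/-- **THE CRUX IN DUAL FORM: `FibreConductance ↔ FibreDualBound`.** The existence of one fibre flow of
the charge `q` with Thomson cost `≤ CL²/‖n‖²` (for every exact zero-free minimiser in the window) is
equivalent, with the same constants, to the dual bound `‖∫qη‖² ≤ (CL²/‖n‖²)·∫|∇₀η|²ψ²/W` for every
`C¹` periodic test function — Thomson's principle for fibre flows (`stub_thomson` +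
`norm_pairing_sq_le`). [folklore] -/
theorem fibreConductance_iff_dual : FibreConductance ↔ FibreDualBound :=
  ⟨dualBound_of_fibreConductance, fibreConductance_of_dualBound stub_thomson⟩

/-- **THE CRUX IN DEFECT DUAL FORM: `FibreConductance ↔ DefectDualBound`.** The crux holds iff, for
exact zero-free minimisers in its window, the EXPLICIT defect charge
`ε = L^{-3/2}[e^{ik·x₀}(k·∇₀ψ)/(i|k|²) + βψ²]` of the transport flow satisfies
`‖∫εη‖² ≤ (D L²/‖n‖²)·∫|∇₀η|²ψ²/W` for every `C¹` periodic test function `η` (constants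
`C ↦ 2(1/4π² + C)` both ways). At `v = 0` (`ψ` constant) `ε ≡ 0`: the whole content of the crux is this
inequality for the interacting landscape. [folklore] -/
theorem fibreConductance_iff_defectDual : FibreConductance ↔ DefectDualBound :=
  ⟨fun h => defectDual_of_fibreDualBound (dualBound_of_fibreConductance h),
    fun h => fibreConductance_of_dualBound stub_thomson (fibreDualBound_of_defectDual h)⟩

/-- **The crux from the two channels IN DUAL FORM** (`GradientDualBound`, `BetaDualBound` — each
implied by its flow form, `gradientDualBound_of_correctorBound`, `betaDualBound_of_correctorBound`):
the dual counterpart of the landed transport reduction `stub_transport`. [folklore] -/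
theorem fibreConductance_of_dual_channels (hg : GradientDualBound) (hb : BetaDualBound) :
    FibreConductance :=
  fibreConductance_of_dualBound stub_thomson
    (fibreDualBound_of_defectDual (defectDual_of_gradient_and_beta hg hb))

end Summit.AtomisticToContinuum.BoseEinsteinCondensation.Cruxes.FibreConductance.HealingSplitKineticDefect

end
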